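import Mathlib
import HarnessLib
import Summits.HubbardSuperconductivity.HubbardSuperconductivity.Theorems.KLProgrammeKLRegimeEngineTowerImportP2Plain
import Summits.HubbardSuperconductivity.HubbardSuperconductivity.Theorems.KLProgrammeKLRegimeEngineThinCount3Doors

/-!
# Route `KLProgramme` — crux K3 ENGINE (stmt-HubbardSuperconductivity-20437 `KLRegimeEngineV17F2`), stub (b) v2 (ℓ), import (I4) at four legs IN FLOOR UNITS
# FROM THE PLAIN LINE: the composed consumer («(ℓ)-IMPORT-ι₂-FLOOR» ∘ «ι₂-PLAIN-LINE»; cell gate-hubbard-kl, seat hubbard-kl-k3c2-p3 g14)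

`…ThinCount3Doors.klTowerMuLevF_two_le_floor_import_doors` (p686720) reads the four-leg floor array of block `k` from the one- and three-anchored counts modulo the
all-fixed anisotropic pinned line `Bₐ` (any leg pinned anywhere); `…AnisoLineFromPlain.fixedTupleL1_klAniso_le_of_plain_klEng` (p586153) turns a PLAIN pinned `L¹`
line `S` of the quartic into the anisotropic all-fixed line `CA⁴·S` at leg `0`, and `…TowerImportP2Plain.pinnedSum_le_of_fixedTupleL1_le` moves the pin to any leg
by translation invariance.  This file composes the three, exactly as `klTowerMeasLev_four_le_of_plainLine_klEng` did for the half-keyed era: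

* **`klTowerMuLevF_two_le_floor_import_of_plainLine_klEng`** — `∃ CA > 0`: under the stub binders (`P.WF`, `R.WF2`, `c ≤ klEngC₃6`, `U ≤ klEngU₀9`, `klEngL₃`,
  `klEngM₃`, `FrameOK`) and the two count doors (`c ≤ klThinCountC₃ R ∧ c ≤ klThinCount3C₃ R`, `U ≤ klThinCountU₀ R ∧ U ≤ klThinCount3U₀ R`), for every block with
  `1 ≤ dk − 1 ≤ nScales β + 1` and every plain line `S ≥ 0` of the quartic of `𝒱_{dk}[K]`:
  `klTowerMuLevF L M β U μ K d k 2 ≤ (1458·klThinCountC + 531441·klThinCount3C)·(CA⁴·S)/ε³` — the ι₂ row of the F-law on the producer target `S` (E1's (Q-ι₂)).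
Proofs only (a composition of landed theorems); nothing about the model is asserted; nothing asserts (ℓ), any stub, K3 or superconductivity.
References: BGM 2006 §2.7 (2.71)/(2.71a), §2.8 (2.96)–(2.98), Lemma 2.5 [cite: BenfattoGiulianiMastropietro2006].
-/

noncomputable section

namespace Summit.HubbardSuperconductivity.HubbardSuperconductivity.Theorems.EngineV8

set_option linter.dupNamespace false -- summit = problem name (single-conjunct summit), D-0017

open Real Finset Literature.MathematicalPhysics.QuantumLattice Literature.Probability.LatticeModels GrassmannAlgebra
open Literature.MathematicalPhysics.QuantumLattice.FermiRG
open Summit.HubbardSuperconductivity.HubbardSuperconductivity.Theorems.KLRegimeSplit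
open Summit.HubbardSuperconductivity.HubbardSuperconductivity.Theorems.KLProgrammeLegKernels
open Summit.HubbardSuperconductivity.HubbardSuperconductivity.Theorems.DispersionFlow
open Summit.HubbardSuperconductivity.HubbardSuperconductivity.Theorems.KLRegimeWick

variable {L M : ℕ} [NeZero L] [NeZero M]

/-- **(I4) AT FOUR LEGS IN FLOOR UNITS FROM THE PLAIN LINE**: `∃ CA > 0` absolute such that, under the stub binders and both count doors, for every block length `d`,
block `k` with `1 ≤ dk − 1 ≤ nScales β + 1`, and `S ≥ 0`: if for all spin/charge strings and every pin the plain four-leg kernel of `𝒱_{dk}[K]` has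
`fixedTupleL1 … ≤ S`, then `klTowerMuLevF L M β U μ K d k 2 ≤ (1458·klThinCountC + 531441·klThinCount3C)·(CA⁴·S)/ε³`.
[cite: BenfattoGiulianiMastropietro2006, §2.7 (2.71a), §2.8 (2.96)-(2.98), Lemma 2.5] -/
theorem klTowerMuLevF_two_le_floor_import_of_plainLine_klEng :
    ∃ CA : ℝ, 0 < CA ∧ ∀ (P : SplitConsts) (R : RenConsts) (c : ℝ), P.WF → R.WF2 → 0 < c → c ≤ klEngC₃6 P R → c ≤ klThinCountC₃ R → c ≤ klThinCount3C₃ R →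
      ∀ μ ∈ klWindowC, ∀ U : ℝ, 0 < U → U ≤ klEngU₀9 P R c → U ≤ klThinCountU₀ R → U ≤ klThinCount3U₀ R → ∀ β : ℝ, klBetaMin ≤ β → β ≤ Real.exp (c / U ^ 2) →
      ∀ K : TrigPolyC4v, FrameOK R U (nScales β) μ K → ∀ (L M : ℕ) [NeZero L] [NeZero M],
      klEngL₃ β U ≤ L → klEngM₃ β U L ≤ M → ∀ d k : ℕ, 1 ≤ d * k - 1 → d * k - 1 ≤ nScales β + 1 →
        ∀ S : ℝ, 0 ≤ S →
          (∀ (s c' : Fin 4 → Fin 2) (y₀ : SpaceTimeIdx L M),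
            fixedTupleL1 L M β 3 (sectorisedKernel L M β (trivialMultiplier L M) (klTowerInput L M β U μ K d k) 4)
              (fun i => (((0 : Fin 1), s i), c' i)) y₀ ≤ S) →
          klTowerMuLevF L M β U μ K d k 2 ≤ (1458 * klThinCountC + 531441 * klThinCount3C) * (CA ^ 4 * S) / imagTimeWeight β M ^ 3 := by
  obtain ⟨CA, hCA, h⟩ := fixedTupleL1_klAniso_le_of_plain_klEng
  refine ⟨CA, hCA, ?_⟩
  intro P R c hP hR2 hc hc6 hcT hcT3 μ hμ U hU hU9 hUT hUT3 β hβmin hβc K hK L M _ _ hL3 hM3 d k hn hnN S hS0 hS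
  have hRj : ∀ j, 0 ≤ R.Gfr j := gfr_nonneg_of_wf2 hR2
  have hβ0 : β ≠ 0 := (lt_of_lt_of_le (by norm_num [klBetaMin]) hβmin).ne'
  have hB : 0 ≤ CA ^ 4 * S := mul_nonneg (pow_nonneg hCA.le 4) hS0
  refine klTowerMuLevF_two_le_floor_import_doors hRj hc hcT hcT3 hU hUT hUT3 hβmin hβc hμ μ hK d k hB ?_
  intro Ω _ p x
  -- the aniso all-fixed line at leg 0 from the plain line, then any leg by translation invariance
  have hline0 : ∀ x₁ : SpaceTimeIdx L M,
      fixedTupleL1 L M β 3 (sectorisedKernel L M β (klAnisoFamily L M β μ K klE0 (d * k - 1)) (klTowerInput L M β U μ K d k) 4) Ω x₁ ≤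
        CA ^ 4 * S := by
    intro x₁
    have hΩ : Ω = fun i => (((Ω i).1.1, (Ω i).1.2), (Ω i).2) := funext fun i => by simp
    rw [hΩ]
    exact h P R c hP hR2 hc hc6 μ hμ U hU hU9 β hβmin hβc K hK L M hL3 hM3 (d * k - 1) hn hnN (klTowerInput L M β U μ K d k)
      (fun i => (Ω i).1.1) (fun i => (Ω i).1.2) (fun i => (Ω i).2) S hS0 (hS _ _) x₁
  unfold klTowerInput at hline0 ⊢
  exact pinnedSum_le_of_fixedTupleL1_le hβ0 _ U μ K klE0 (d * k) Ω hline0 p x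

end Summit.HubbardSuperconductivity.HubbardSuperconductivity.Theorems.EngineV8

end
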